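import Summits.BirchSwinnertonDyer.BirchSwinnertonDyer.Theorems.SignedLowerHalvesBDKimMinusCyclicOfHonda
import Summits.BirchSwinnertonDyer.BirchSwinnertonDyer.Theorems.ThetaPartnerAtTwoSignedKatoUpToAtTwoFlatEqualsPlus
import Summits.BirchSwinnertonDyer.BirchSwinnertonDyer.Theorems.ThetaPartnerAtTwoSignedKatoUpToAtTwoFlatSelmerPlus
import HarnessLib

/-!
# `Ker Col♯ = Ann(⨆ₙ E⁻_n)` at `a_p = 0` and the two local inclusions «Kobayashi's MINUS Kummer condition = Sprung's `♯`
# condition» over `K_∞` — the `♯`/minus twin of the TP2 width seat's `…FlatKernelPlus` / `…FlatSelmerPlus` §1 /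
# `…FlatEqualsPlus` §1–§2 (any `K`, `p`, `κ`, `ι`), plus the global inclusion `Sel⁻(E/K_∞) ≤ Sel♯(E/K_∞)` for a number field

LADDER-BSD D-0154 (2) INPUTS→UNCONDITIONAL, INPUTS-LIST-2 row F10 (ADDENDUM-5 §C, tranche T2b, the `ε = −1` half), seat
`bsd-inputs-kim315-p1` (gen 2); `--supports` stmt-BirchSwinnertonDyer-19288 (B. D. Kim 2013 Cor. 3.15 BY NAME). Second file of
the minus port (first: `…BDKimMinusCyclicOfHonda.lean`, CYC⁻). HONEST FRAMING: THEOREMS ONLY (no definition, no named fact, no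
instance, no `sorry`); kernel algebra on the tree's transcription of Sprung's Coleman map with DISPLAYED Honda clauses;
route-independent; closes nothing; BSD is not proved by any of this.

## The argument (mirror of files 16/17/20 of the TP2 `colemanrat` line, parities swapped)

At `a_p = 0`, `u_n = 0` for even `n` and `v_n = 0` for odd `n` (`sharpPoly_zero_of_even`, `flatPoly_zero_of_odd`). (A♯) If a
functional `z` on `E(K_∞·K_v)` kills every `E⁻(K_n·K_v)`, take its Coleman value `(L♯, L♭)` (`SSFlatEC.exists_isColemanPair_of_trace`);
then `(0, L♭)` is also a Coleman value: at even levels the condition does not involve `L♯`, at ODD levels it reads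
`ω_n ∣ P_{n,d_n}(z)` and the pairing sum vanishes identically because `d_n ∈ E⁻_n` for odd `n` (`d_odd_mem_signedLocalPointsOfEmb_neg_one`)
and `E⁻_n` is `Γ`-stable; so `z ∈ Ker Col♯`. (B♯) If `Col♯(z) = 0`, at odd `n` Weierstrass uniqueness
(`forall_evalOn_eq_zero_of_omega_dvd_pairingSum`) gives `z(gʲ d_n) = 0` for `j < pⁿ`, hence `z` kills the `Γ_{K_v}`-orbit span of
`d_n`; CYC⁻ (`minusCyclic_odd_of_honda`) gives `z(E⁻_n) ⊆ p^k ℤ_p` for all `k`, so `z(E⁻_n) = 0`; even layers reduce to odd ones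
(`E⁻_0 ≤ E⁻_1 = E(K_1·K_v)`, `E⁻_{2j+2} ≤ E⁻_{2j+1}`). Then, verbatim as in files 17/20: the minus Kummer condition implies the `♯`
condition (B♯), and conversely (A♯ + Pontryagin duality for the `p`-torsion-free quotient `E(K_∞·K_v)/⨆ₙ E⁻_n`, saturation
`KummerPoint.iSup_signedLocalPointsOfEmb_saturated` at `ε = −1`).

## What is proved (namespace `…Theorems.SignedKatoOffTwo.SharpKernel`)

* §1 `mem_colemanKer_sharp_of_forall_minus` (A♯; (L), (TR), `g`).
* §2 `apply_eq_zero_of_mem_colemanKer_sharp_of_mem_minus` (B♯; (NT), (IDX), (L), (TR), (GEN), (CYC₁), `g`).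
* §3 `localKummerOverOfEmb_iSup_minus_le_sharpFlatLocalKummer`, `noPTorsion_towerQuotMinus`,
  `sharpFlatLocalKummer_le_localKummerOverOfEmb_iSup_minus`, `sharpFlatLocalKummer_eq_localKummerOverOfEmb_iSup_minus`.
* §4 (number field `K`) `signedSelmerInfty_neg_one_le_sharpFlatSelmerInfty_sharp` (`Sel⁻(E/K_∞) ≤ Sel♯(E/K_∞)`),
  `conjH1_mem_localKummerOverOfEmb_iSup_minus_of_mem_sharpFlatSelmerInfty`.

References: [Kobayashi2003] Def. 1.1, Thm. 6.2, Prop. 8.12, Thm. 8.18–Prop. 8.23; [Sprung2012] Def. 5.9, Def. 7.1–7.2, Def. 7.9–7.11,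
Open Problem 7.22; [Sprung2017] Cor. 4.4; [NeukirchSchmidtWingberg2008] I §1 (1.1.8). Credit: seats tp2-p2x-w2 (files 16/17/20),
bsd-2adic (`SSFlatEC` Coleman clauses), tp2-p3-w3 (CYC), mirrored here.
-/

set_option autoImplicit false
-- the Theorems namespace of this sub repeats the summit name by design (D-0017 nested layout)
set_option linter.dupNamespace false

noncomputable section

open scoped Classical NumberField

universe u

namespace Summit.BirchSwinnertonDyer.BirchSwinnertonDyer.Theorems

namespace SignedKatoOffTwo.SharpKernel

open Polynomial NumberField IsDedekindDomain WeierstrassCurve Literature.NumberTheory.EllipticCurves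
  Literature.NumberTheory.GaloisRepresentations Literature.NumberTheory.EllipticCurves.ZpExtension
  Literature.NumberTheory.EllipticCurves.Kobayashi2003 Literature.NumberTheory.EllipticCurves.Sprung2017
  Literature.NumberTheory.EllipticCurves.Sprung2012 Literature.NumberTheory.EllipticCurves.Rank1Residual
  Summit.BirchSwinnertonDyer.Rank1Residual.Supersingular SignedKatoOffTwo.FlatKernel

/-! ## §1 (A♯) `Ann(⨆ₙ E⁻_n) ⊆ Ker Col♯` at `a_p = 0` -/

section Local

variable {K : Type u} [Field K] {p : ℕ} [hp : Fact p.Prime] (κ : ZpExtension K p)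
variable {E : Type u} [Field E] [Algebra K E] (ι : AlgebraicClosure K →ₐ[K] AlgebraicClosure E)
variable (W : WeierstrassCurve K)

/-- **(A♯) A functional killing Kobayashi's minus groups lies in `Ker Col♯`, at `a_p = 0`.** For a Honda system `d` with (L), (TR)
`Tr_{m+2/m+1} d_{m+2} = −d_m`, a local lift `g` of the topological generator, and a functional `z` on `E(K_∞·K_v)` with `z(x) = 0`
for every `x ∈ E⁻(K_n·K_v)` and every `n`: `z ∈ Ker Col♯` (`colemanKer … 0 g d .sharp`). If `(L♯, L♭)` is a Coleman value of `z`,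
so is `(0, L♭)`: even levels do not involve `L♯` (`u_n = 0`); at odd levels `v_n = 0` and `P_{n,d_n}(z) = 0` (`d_n ∈ E⁻_n`,
`Γ`-stable, killed by `z`). [cite: Sprung2012, Def. 5.9 (p. 1495), Def. 7.1–7.2 and Def. 7.9 (pp. 1500–1503)]
[cite: Kobayashi2003, Prop. 8.12 i), Thm. 8.18 (pp. 17–19)] [cite: Sprung2017, Cor. 4.4] -/
theorem mem_colemanKer_sharp_of_forall_minus {g : Field.absoluteGaloisGroup E}
    (hg : κ.IsTopGenerator (resGalOfEmb ι g)) {d : ℕ → localPoints W E}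
    (hd : ∀ m, d m ∈ localLayerPointsOfEmb κ ι W m)
    (htr : ∀ m, localTraceOfEmb κ ι W (m + 1) (m + 2) (d (m + 2)) = -d m)
    (z : localTowerPointsOfEmb κ ι W →+ ℤ_[p])
    (hz : ∀ (n : ℕ) (x : localTowerPointsOfEmb κ ι W),
      (x : localPoints W E) ∈ signedLocalPointsOfEmb κ ι W (-1) n → z x = 0) :
    z ∈ colemanKer κ ι W 0 g d .sharp := by
  obtain ⟨Ls, Lf, hCP⟩ :=
    SSFlatEC.exists_isColemanPair_of_trace κ ι W hg (dvd_zero _) hd (honda_trace_ap_zero κ ι W htr) z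
  refine ⟨0, Lf, fun n => ?_, by rw [chromaticL_sharp]⟩
  rcases Nat.even_or_odd n with hn | hn
  · -- even level: `u_n = 0`, the condition is that of `(L♯, L♭)`
    have h := hCP n
    simp only [sharpPoly_zero_of_even p hn, map_zero, zero_mul, zero_add] at h ⊢
    exact h
  · -- odd level: the pairing sum vanishes identically and `v_n = 0`
    have hsum : pairingSum W (localTowerPointsOfEmb κ ι W) g n (d n) z = 0 := by
      rw [pairingSum_def]
      refine Finset.sum_eq_zero fun j _ => ?_
      have hdn : d n ∈ signedLocalPointsOfEmb κ ι W (-1) n := by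
        obtain ⟨k, hk⟩ := hn
        rw [hk]
        exact SignedEC.d_odd_mem_signedLocalPointsOfEmb_neg_one W κ ι d hd htr k
      have hmem : g ^ j • d n ∈ signedLocalPointsOfEmb κ ι W (-1) n :=
        SignedEC.closure_orbit_le_signedLocalPointsOfEmb W κ ι (-1) n hdn (AddSubgroup.subset_closure ⟨g ^ j, rfl⟩)
      have hT : g ^ j • d n ∈ localTowerPointsOfEmb κ ι W :=
        localLayerPointsOfEmb_le_localTowerPointsOfEmb κ ι W n (signedLocalPointsOfEmb_le κ ι W (-1) n hmem)
      rw [evalOn_of_mem W _ z hT, hz n ⟨_, hT⟩ hmem, map_zero, zero_mul]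
    rw [hsum, flatPoly_zero_of_odd p hn]
    simp only [map_zero, zero_mul, mul_zero, add_zero]
    exact dvd_zero _

/-! ## §2 (B♯) `Ker Col♯ ⊆ Ann(⨆ₙ E⁻_n)` at `a_p = 0` -/

/-- **(B♯) A functional in `Ker Col♯` kills every minus group `E⁻(K_n·K_v)`, at `a_p = 0`.** Hypotheses: (NT), (IDX), a Honda
system `d` with (L), (TR), (GEN), the base clause (CYC₁) `E(K_1·K_v) = ℤ[Γ]·d_1 + p·E(K_1·K_v)`, and a local lift `g` of the
topological generator. Proof: `Col♯(z) = 0` and `v_n = 0` (odd `n`) give `ω_n ∣ P_{n,d_n}(z)`, so `z(gʲ d_n) = 0` for `j < pⁿ`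
(Weierstrass uniqueness), so `z` kills the `Γ_{K_v}`-orbit span of `d_n`; CYC⁻ (`SignedEC.minusCyclic_odd_of_honda`) then gives
`z(E⁻_n) ⊆ p^k ℤ_p` for every `k`, hence `z(E⁻_n) = 0`; even `n` reduce to odd (`E⁻_0 ≤ E⁻_1`, `E⁻_{2j+2} ≤ E⁻_{2j+1}`).
[cite: Kobayashi2003, Prop. 8.12, Thm. 8.18–Prop. 8.23 (pp. 17–21)] [cite: Sprung2012, Def. 5.9, Def. 7.1, Def. 7.9 (pp. 1495–1503)]
[cite: Sprung2017, Cor. 4.4] -/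
theorem apply_eq_zero_of_mem_colemanKer_sharp_of_mem_minus {g : Field.absoluteGaloisGroup E}
    (hg : κ.IsTopGenerator (resGalOfEmb ι g))
    (hnt : ∀ P ∈ localTowerPointsOfEmb κ ι W, p • P = 0 → P = 0)
    (hidx : ∀ m : ℕ, ((localLayerSubgroupOfEmb κ ι (m + 1)).subgroupOf (localLayerSubgroupOfEmb κ ι m)).index = p)
    {d : ℕ → localPoints W E} (hd : ∀ m, d m ∈ localLayerPointsOfEmb κ ι W m)
    (htr : ∀ m, localTraceOfEmb κ ι W (m + 1) (m + 2) (d (m + 2)) = -d m)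
    (hgen : ∀ m : ℕ, 1 ≤ m → ∀ P ∈ localLayerPointsOfEmb κ ι W m,
      ∃ B ∈ AddSubgroup.closure (Set.range fun σ : Field.absoluteGaloisGroup E ↦ σ • d m),
        ∃ P' ∈ localLayerPointsOfEmb κ ι W (m - 1), ∃ R ∈ localLayerPointsOfEmb κ ι W m, P = B + P' + p • R)
    (hcyc1 : ∀ x ∈ localLayerPointsOfEmb κ ι W 1,
      ∃ B ∈ AddSubgroup.closure (Set.range fun σ : Field.absoluteGaloisGroup E ↦ σ • d 1),
        ∃ b ∈ localLayerPointsOfEmb κ ι W 1, x = B + p • b)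
    {z : localTowerPointsOfEmb κ ι W →+ ℤ_[p]} (hz : z ∈ colemanKer κ ι W 0 g d .sharp)
    (n : ℕ) (x : localTowerPointsOfEmb κ ι W) (hx : (x : localPoints W E) ∈ signedLocalPointsOfEmb κ ι W (-1) n) :
    z x = 0 := by
  -- reduce to odd layers
  suffices key : ∀ (j : ℕ) (y : localTowerPointsOfEmb κ ι W),
      (y : localPoints W E) ∈ signedLocalPointsOfEmb κ ι W (-1) (2 * j + 1) → z y = 0 by
    rcases Nat.even_or_odd n with ⟨j, hj⟩ | ⟨j, hj⟩
    · rcases j with _ | j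
      · -- `n = 0`: `E⁻_0 = E(K_v) ≤ E(K_1·K_v) = E⁻_1`
        subst hj
        refine key 0 x ?_
        rw [Nat.mul_zero, Nat.zero_add, SignedEC.signedLocalPointsOfEmb_neg_one_one]
        rw [Nat.add_zero, signedLocalPointsOfEmb_zero] at hx
        exact localLayerPointsOfEmb_mono κ ι W (Nat.zero_le 1) hx
      · -- `n = 2j+2 ≤` layer `2j+1`
        subst hj
        refine key j x (SignedEC.signedLocalPointsOfEmb_neg_one_even_succ_le W κ ι hnt j ?_)
        rw [show 2 * j + 2 = j + 1 + (j + 1) by ring]; exact hx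
    · subst hj
      exact key j x hx
  intro j
  -- Step 1: `ω_{2j+1} ∣ P_{2j+1, d_{2j+1}}(z)` from `Col♯(z) = 0` and `v_{2j+1} = 0`
  obtain ⟨Ls, Lf, hCP, hLs⟩ := hz
  rw [chromaticL_sharp] at hLs
  subst hLs
  have hdvd : toIwasawa p (cyclotomicOmega p (2 * j + 1)) ∣
      pairingSum W (localTowerPointsOfEmb κ ι W) g (2 * j + 1) (d (2 * j + 1)) z := by
    have h := hCP (2 * j + 1)
    simp only [flatPoly_zero_of_odd p (odd_two_mul_add_one j), map_zero, zero_mul, mul_zero, add_zero] at h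
    exact h
  -- Step 2: `z` vanishes on the `g`-orbit, hence on the `Γ`-orbit span of `d_{2j+1}`
  have horb0 := forall_evalOn_eq_zero_of_omega_dvd_pairingSum W hdvd
  have hspan : AddSubgroup.closure (Set.range fun σ : Field.absoluteGaloisGroup E ↦ σ • d (2 * j + 1)) ≤
      (AddMonoidHom.ker z).map (localTowerPointsOfEmb κ ι W).subtype := by
    rw [AddSubgroup.closure_le]
    rintro _ ⟨σ, rfl⟩
    obtain ⟨e, he, heq⟩ := exists_pow_smul_eq_smul κ ι W hg (hd (2 * j + 1)) σ
    have hT : g ^ e • d (2 * j + 1) ∈ localTowerPointsOfEmb κ ι W :=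
      smul_mem_localTowerPointsOfEmb κ ι W _ (localLayerPointsOfEmb_le_localTowerPointsOfEmb κ ι W _ (hd _))
    refine ⟨⟨g ^ e • d (2 * j + 1), hT⟩, ?_, heq.symm⟩
    rw [SetLike.mem_coe, AddMonoidHom.mem_ker]
    have h0 := horb0 e he
    rwa [evalOn_of_mem W _ z hT] at h0
  have hkill : ∀ B ∈ AddSubgroup.closure (Set.range fun σ : Field.absoluteGaloisGroup E ↦ σ • d (2 * j + 1)),
      ∀ hB : B ∈ localTowerPointsOfEmb κ ι W, z ⟨B, hB⟩ = 0 := by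
    intro B hB hBT
    obtain ⟨t, ht, htB⟩ := hspan hB
    have : (⟨B, hBT⟩ : localTowerPointsOfEmb κ ι W) = t := Subtype.ext htB.symm
    rw [this]
    exact ht
  -- Step 3: CYC⁻ ⟹ `z(E⁻_{2j+1}) ⊆ p^k ℤ_p` for every `k`
  have hcyc := SignedEC.minusCyclic_odd_of_honda W κ ι hnt hidx d hd htr hgen hcyc1 j
  have hind : ∀ (k : ℕ) (y : localTowerPointsOfEmb κ ι W),
      (y : localPoints W E) ∈ signedLocalPointsOfEmb κ ι W (-1) (2 * j + 1) → (p : ℤ_[p]) ^ k ∣ z y := by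
    intro k
    induction k with
    | zero => intro y _; rw [pow_zero]; exact one_dvd _
    | succ k ih =>
      intro y hy
      obtain ⟨B, hB, b, hb, hyB⟩ := hcyc y hy
      have hbT : b ∈ localTowerPointsOfEmb κ ι W :=
        localLayerPointsOfEmb_le_localTowerPointsOfEmb κ ι W _ (signedLocalPointsOfEmb_le κ ι W (-1) _ hb)
      have hBT : B ∈ localTowerPointsOfEmb κ ι W := by
        have h : B = (y : localPoints W E) - p • b := eq_sub_of_add_eq hyB.symm
        rw [h]
        exact sub_mem y.2 (AddSubgroup.nsmul_mem _ hbT _)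
      have hysum : y = ⟨B, hBT⟩ + p • ⟨b, hbT⟩ := Subtype.ext (by simpa using hyB)
      rw [hysum, map_add, map_nsmul, hkill B hB hBT, zero_add, nsmul_eq_mul, pow_succ']
      exact mul_dvd_mul_left _ (ih ⟨b, hbT⟩ hb)
  -- Step 4: `p`-adic separation
  intro y hy
  exact SSFlatEC.padicInt_eq_zero_of_forall_pow_dvd (fun k => hind k y hy)

/-! ## §3 The minus Kummer condition over `K_∞` and the `♯` condition coincide (local, any base) -/

/-- `⨆_n E⁻(K_n·K_v) ≤ E(K_∞·K_v)`. [cite: Kobayashi2003, Def. 1.1] -/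
theorem iSup_minus_le_localTowerPointsOfEmb :
    (⨆ n : ℕ, signedLocalPointsOfEmb κ ι W (-1) n) ≤ localTowerPointsOfEmb κ ι W :=
  iSup_le fun n => (signedLocalPointsOfEmb_le κ ι W (-1) n).trans (localLayerPointsOfEmb_le_localTowerPointsOfEmb κ ι W n)

/-- **`Ker Col♯` kills `⨆_n E⁻(K_n·K_v)`** ((B♯) on each minus group, extended to the `⨆` by additivity).
[cite: Kobayashi2003, Thm. 8.18–Prop. 8.23] [cite: Sprung2012, Def. 7.9 (p. 1503)] -/
theorem apply_eq_zero_of_mem_colemanKer_sharp_of_mem_iSup_minus {g : Field.absoluteGaloisGroup E}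
    (hg : κ.IsTopGenerator (resGalOfEmb ι g))
    (hnt : ∀ P ∈ localTowerPointsOfEmb κ ι W, p • P = 0 → P = 0)
    (hidx : ∀ m : ℕ, ((localLayerSubgroupOfEmb κ ι (m + 1)).subgroupOf (localLayerSubgroupOfEmb κ ι m)).index = p)
    {d : ℕ → localPoints W E} (hd : ∀ m, d m ∈ localLayerPointsOfEmb κ ι W m)
    (htr : ∀ m, localTraceOfEmb κ ι W (m + 1) (m + 2) (d (m + 2)) = -d m)
    (hgen : ∀ m : ℕ, 1 ≤ m → ∀ P ∈ localLayerPointsOfEmb κ ι W m,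
      ∃ B ∈ AddSubgroup.closure (Set.range fun σ : Field.absoluteGaloisGroup E ↦ σ • d m),
        ∃ P' ∈ localLayerPointsOfEmb κ ι W (m - 1), ∃ R ∈ localLayerPointsOfEmb κ ι W m, P = B + P' + p • R)
    (hcyc1 : ∀ x ∈ localLayerPointsOfEmb κ ι W 1,
      ∃ B ∈ AddSubgroup.closure (Set.range fun σ : Field.absoluteGaloisGroup E ↦ σ • d 1),
        ∃ b ∈ localLayerPointsOfEmb κ ι W 1, x = B + p • b)
    {z : localTowerPointsOfEmb κ ι W →+ ℤ_[p]} (hz : z ∈ colemanKer κ ι W 0 g d .sharp)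
    {x : localPoints W E} (hx : x ∈ ⨆ n : ℕ, signedLocalPointsOfEmb κ ι W (-1) n) :
    z ⟨x, iSup_minus_le_localTowerPointsOfEmb κ ι W hx⟩ = 0 := by
  refine AddSubgroup.iSup_induction' (fun n : ℕ => signedLocalPointsOfEmb κ ι W (-1) n)
    (C := fun y hy => z ⟨y, iSup_minus_le_localTowerPointsOfEmb κ ι W hy⟩ = 0) ?_ ?_ ?_ hx
  · intro n y hy
    exact apply_eq_zero_of_mem_colemanKer_sharp_of_mem_minus κ ι W hg hnt hidx hd htr hgen hcyc1 hz n _ hy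
  · exact (congrArg z (Subtype.ext rfl)).trans (map_zero z)
  · intro a b ha hb hza hzb
    have hab : (⟨a + b, iSup_minus_le_localTowerPointsOfEmb κ ι W (add_mem ha hb)⟩ : localTowerPointsOfEmb κ ι W) =
        ⟨a, iSup_minus_le_localTowerPointsOfEmb κ ι W ha⟩ + ⟨b, iSup_minus_le_localTowerPointsOfEmb κ ι W hb⟩ :=
      Subtype.ext rfl
    rw [hab, map_add, hza, hzb, add_zero]

/-- **Kobayashi's minus Kummer condition ≤ Sprung's `♯` Kummer condition, at `a_p = 0`** (any `H ≤ Γ_K`): a class whose restriction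
at `ι` is the Kummer cocycle of `Q` with `p^k Q ∈ ⨆_n E⁻(K_n·K_v)` satisfies «`p^k Q ∈ E(K_∞·K_v)` and `p^k ∣ z(p^k Q)` for all
`z ∈ Ker Col♯`» — indeed `z(p^k Q) = 0`. [cite: Sprung2012, Def. 7.9 and Def. 7.11 (p. 1503)] [cite: Kobayashi2003, Def. 1.1, Thm. 8.18–Prop. 8.23] -/
theorem localKummerOverOfEmb_iSup_minus_le_sharpFlatLocalKummer (H : Subgroup (Field.absoluteGaloisGroup K))
    {g : Field.absoluteGaloisGroup E} (hg : κ.IsTopGenerator (resGalOfEmb ι g))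
    (hnt : ∀ P ∈ localTowerPointsOfEmb κ ι W, p • P = 0 → P = 0)
    (hidx : ∀ m : ℕ, ((localLayerSubgroupOfEmb κ ι (m + 1)).subgroupOf (localLayerSubgroupOfEmb κ ι m)).index = p)
    {d : ℕ → localPoints W E} (hd : ∀ m, d m ∈ localLayerPointsOfEmb κ ι W m)
    (htr : ∀ m, localTraceOfEmb κ ι W (m + 1) (m + 2) (d (m + 2)) = -d m)
    (hgen : ∀ m : ℕ, 1 ≤ m → ∀ P ∈ localLayerPointsOfEmb κ ι W m,
      ∃ B ∈ AddSubgroup.closure (Set.range fun σ : Field.absoluteGaloisGroup E ↦ σ • d m),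
        ∃ P' ∈ localLayerPointsOfEmb κ ι W (m - 1), ∃ R ∈ localLayerPointsOfEmb κ ι W m, P = B + P' + p • R)
    (hcyc1 : ∀ x ∈ localLayerPointsOfEmb κ ι W 1,
      ∃ B ∈ AddSubgroup.closure (Set.range fun σ : Field.absoluteGaloisGroup E ↦ σ • d 1),
        ∃ b ∈ localLayerPointsOfEmb κ ι W 1, x = B + p • b) :
    localKummerOverOfEmb W p H ι (⨆ n : ℕ, signedLocalPointsOfEmb κ ι W (-1) n) ≤
      sharpFlatLocalKummerOverOfEmb W p H ι (localTowerPointsOfEmb κ ι W) (colemanKer κ ι W 0 g d .sharp) := by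
  rintro c ⟨φ, Q, k, hc, hA, hτ⟩
  refine ⟨φ, Q, k, iSup_minus_le_localTowerPointsOfEmb κ ι W hA, hc, fun z hz => ?_, hτ⟩
  rw [apply_eq_zero_of_mem_colemanKer_sharp_of_mem_iSup_minus κ ι W hg hnt hidx hd htr hgen hcyc1 hz hA]
  exact dvd_zero _

/-- **`E(K_∞·K_v) / ⨆ₙ E⁻(K_n·K_v)` has no `p`-torsion** under (NT): the minus union is `p`-saturated in the tower
(`KummerPoint.iSup_signedLocalPointsOfEmb_saturated` at `ε = −1`). [cite: Kobayashi2003, §2 p. 4 and Prop. 8.7] -/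
theorem noPTorsion_towerQuotMinus (hnt : ∀ P ∈ localTowerPointsOfEmb κ ι W, p • P = 0 → P = 0)
    (y : ↥(localTowerPointsOfEmb κ ι W) ⧸
      (⨆ n : ℕ, signedLocalPointsOfEmb κ ι W (-1) n).addSubgroupOf (localTowerPointsOfEmb κ ι W))
    (hy : p • y = 0) : y = 0 := by
  obtain ⟨y, rfl⟩ := QuotientAddGroup.mk_surjective y
  rw [← QuotientAddGroup.mk_nsmul, QuotientAddGroup.eq_zero_iff, AddSubgroup.mem_addSubgroupOf,
    AddSubgroupClass.coe_nsmul] at hy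
  rw [QuotientAddGroup.eq_zero_iff, AddSubgroup.mem_addSubgroupOf]
  exact KummerPoint.iSup_signedLocalPointsOfEmb_saturated W κ ι hnt (-1) _ y.2 hy

/-- **The `♯` condition implies the minus Kummer condition over `K_∞`** (exact annihilator; `g`, (NT), (L), (TR) only): for a class
with witness `x ⊗ p^{-k}`, `x ∈ E(K_∞·K_v)`, pairing integrally with `Ker Col♯`, `ann(⨆ₙ E⁻_n) ⊆ Ker Col♯` (§1) and Pontryagin
duality for the `p`-torsion-free quotient `E(K_∞·K_v)/⨆ₙ E⁻_n` give `x ∈ ⨆ₙ E⁻_n + p^k E(K_∞·K_v)`; translating the witness by a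
tower point does not change the cocycle. [cite: Kobayashi2003, Thm. 6.2 and Prop. 8.18–8.23] [cite: Sprung2012, Def. 7.9 (p. 1503)]
[cite: NeukirchSchmidtWingberg2008, I §1 (1.1.8)] -/
theorem sharpFlatLocalKummer_le_localKummerOverOfEmb_iSup_minus {g : Field.absoluteGaloisGroup E}
    (hg : κ.IsTopGenerator (resGalOfEmb ι g))
    (hnt : ∀ P ∈ localTowerPointsOfEmb κ ι W, p • P = 0 → P = 0)
    {d : ℕ → localPoints W E} (hd : ∀ m, d m ∈ localLayerPointsOfEmb κ ι W m)
    (htr : ∀ m, localTraceOfEmb κ ι W (m + 1) (m + 2) (d (m + 2)) = -d m) :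
    sharpFlatLocalKummerOverOfEmb W p κ.kerSubgroup ι (localTowerPointsOfEmb κ ι W) (colemanKer κ ι W 0 g d .sharp) ≤
      localKummerOverOfEmb W p κ.kerSubgroup ι (⨆ n : ℕ, signedLocalPointsOfEmb κ ι W (-1) n) := by
  rintro c ⟨φ, Q, k, hQ, hc, hdiv, hτ⟩
  set T : AddSubgroup (localPoints W E) := localTowerPointsOfEmb κ ι W with hT
  set A : AddSubgroup (localPoints W E) := ⨆ n : ℕ, signedLocalPointsOfEmb κ ι W (-1) n with hA
  set A' : AddSubgroup T := A.addSubgroupOf T with hA'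
  have hN : ∀ y : T ⧸ A', p • y = 0 → y = 0 := noPTorsion_towerQuotMinus κ ι W hnt
  have hker : ∀ zbar : T ⧸ A' →+ ℤ_[p],
      zbar.comp (QuotientAddGroup.mk' A') ∈ colemanKer κ ι W 0 g d .sharp := by
    intro zbar
    refine mem_colemanKer_sharp_of_forall_minus κ ι W hg hd htr _ fun n x hx => ?_
    have hx0 : (QuotientAddGroup.mk' A' x : T ⧸ A') = 0 := by
      rw [QuotientAddGroup.mk'_apply, QuotientAddGroup.eq_zero_iff, AddSubgroup.mem_addSubgroupOf]
      exact (le_iSup (fun n : ℕ => signedLocalPointsOfEmb κ ι W (-1) n) n) hx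
    rw [AddMonoidHom.comp_apply, hx0, map_zero]
  set x : T := ⟨p ^ k • Q, hQ⟩ with hx
  have hdvd : ∀ zbar : T ⧸ A' →+ ℤ_[p], (p : ℤ_[p]) ^ k ∣ zbar (QuotientAddGroup.mk x) := by
    intro zbar
    have h := hdiv _ (hker zbar)
    rwa [AddMonoidHom.comp_apply, QuotientAddGroup.mk'_apply] at h
  obtain ⟨ybar, hybar⟩ :=
    Literature.Algebra.Module.exists_nsmul_eq_of_forall_addMonoidHom_padicInt_dvd hN hdvd
  obtain ⟨y, rfl⟩ := QuotientAddGroup.mk_surjective ybar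
  have hmem : p ^ k • Q - p ^ k • (y : localPoints W E) ∈ A := by
    have h1 : (QuotientAddGroup.mk (x - p ^ k • y) : T ⧸ A') = 0 := by
      rw [QuotientAddGroup.mk_sub, QuotientAddGroup.mk_nsmul, hybar, sub_self]
    rw [QuotientAddGroup.eq_zero_iff, AddSubgroup.mem_addSubgroupOf, AddSubgroupClass.coe_sub,
      AddSubgroupClass.coe_nsmul] at h1
    exact h1
  refine ⟨φ, Q - y, k, hc, by rwa [smul_sub], fun τ => ?_⟩
  have hy : (τ : Field.absoluteGaloisGroup E) • (y : localPoints W E) = y :=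
    (mem_localTowerPointsOfEmb_iff κ ι W (y : localPoints W E)).1 y.2 τ τ.2
  rw [hτ τ, smul_sub, hy]
  abel

/-- **The two local conditions over `K_∞` COINCIDE at `a_p = 0` (minus / `♯`)**: `E♯_∞ = (⨆ₙ E⁻_n) ⊗ ℚ_p/ℤ_p` inside
`H¹(K_∞, E[p^∞])` (restricted along `ι`), under `g`, (NT), (IDX), (L), (TR), (GEN), (CYC₁).
[cite: Kobayashi2003, Thm. 6.2, Prop. 8.18–8.23] [cite: Sprung2012, Def. 7.9 (p. 1503)] -/
theorem sharpFlatLocalKummer_eq_localKummerOverOfEmb_iSup_minus {g : Field.absoluteGaloisGroup E}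
    (hg : κ.IsTopGenerator (resGalOfEmb ι g))
    (hnt : ∀ P ∈ localTowerPointsOfEmb κ ι W, p • P = 0 → P = 0)
    (hidx : ∀ m : ℕ, ((localLayerSubgroupOfEmb κ ι (m + 1)).subgroupOf (localLayerSubgroupOfEmb κ ι m)).index = p)
    {d : ℕ → localPoints W E} (hd : ∀ m, d m ∈ localLayerPointsOfEmb κ ι W m)
    (htr : ∀ m, localTraceOfEmb κ ι W (m + 1) (m + 2) (d (m + 2)) = -d m)
    (hgen : ∀ m : ℕ, 1 ≤ m → ∀ P ∈ localLayerPointsOfEmb κ ι W m,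
      ∃ B ∈ AddSubgroup.closure (Set.range fun σ : Field.absoluteGaloisGroup E ↦ σ • d m),
        ∃ P' ∈ localLayerPointsOfEmb κ ι W (m - 1), ∃ R ∈ localLayerPointsOfEmb κ ι W m, P = B + P' + p • R)
    (hcyc1 : ∀ x ∈ localLayerPointsOfEmb κ ι W 1,
      ∃ B ∈ AddSubgroup.closure (Set.range fun σ : Field.absoluteGaloisGroup E ↦ σ • d 1),
        ∃ b ∈ localLayerPointsOfEmb κ ι W 1, x = B + p • b) :
    sharpFlatLocalKummerOverOfEmb W p κ.kerSubgroup ι (localTowerPointsOfEmb κ ι W) (colemanKer κ ι W 0 g d .sharp) =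
      localKummerOverOfEmb W p κ.kerSubgroup ι (⨆ n : ℕ, signedLocalPointsOfEmb κ ι W (-1) n) :=
  le_antisymm (sharpFlatLocalKummer_le_localKummerOverOfEmb_iSup_minus κ ι W hg hnt hd htr)
    (localKummerOverOfEmb_iSup_minus_le_sharpFlatLocalKummer κ ι W κ.kerSubgroup hg hnt hidx hd htr hgen hcyc1)

end Local

/-! ## §4 `Sel⁻(E/K_∞) ≤ Sel♯(E/K_∞)` and the `♯` classes are minus-Kummer (number field `K`, one place above `p`) -/

section Global

variable {K : Type u} [Field K] [NumberField K] (W : WeierstrassCurve K) {p : ℕ} [hp : Fact p.Prime]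
  (κ : ZpExtension K p)

/-- **`Sel⁻(E/K_∞) ≤ Sel♯(E/K_∞)` at `a_p = 0`** (twin of `signedSelmerInfty_le_sharpFlatSelmerInfty_flat`): the classical parts agree
and, at every conjugate, the minus Kummer condition over `K_∞` (`conjH1_mem_localKummerOverOfEmb_iSup_of_mem_signedSelmerInfty` at
`ε = −1`) implies the `♯` condition (§3). [cite: Kobayashi2003, Def. 1.1] [cite: Sprung2012, Def. 7.11 (p. 1503)] -/
theorem signedSelmerInfty_neg_one_le_sharpFlatSelmerInfty_sharp (v : HeightOneSpectrum (𝓞 K)) (hv : (p : 𝓞 K) ∈ v.asIdeal)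
    {g : Field.absoluteGaloisGroup (v.adicCompletion K)}
    (hg : κ.IsTopGenerator (resGalOfEmb (closureEmb (K := K) (v.adicCompletion K)) g))
    (hnt : ∀ P ∈ localTowerPointsOfEmb κ (closureEmb (K := K) (v.adicCompletion K)) W, p • P = 0 → P = 0)
    (hidx : ∀ m : ℕ, ((localLayerSubgroupOfEmb κ (closureEmb (K := K) (v.adicCompletion K)) (m + 1)).subgroupOf
      (localLayerSubgroupOfEmb κ (closureEmb (K := K) (v.adicCompletion K)) m)).index = p)
    {d : ℕ → localPoints W (v.adicCompletion K)}
    (hd : ∀ m, d m ∈ localLayerPoints κ (v.adicCompletion K) W m)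
    (htr : ∀ m, localTrace κ (v.adicCompletion K) W (m + 1) (m + 2) (d (m + 2)) = -d m)
    (hgen : ∀ m : ℕ, 1 ≤ m → ∀ P ∈ localLayerPoints κ (v.adicCompletion K) W m,
      ∃ B ∈ AddSubgroup.closure (Set.range fun σ : Field.absoluteGaloisGroup (v.adicCompletion K) ↦ σ • d m),
        ∃ P' ∈ localLayerPoints κ (v.adicCompletion K) W (m - 1),
          ∃ R ∈ localLayerPoints κ (v.adicCompletion K) W m, P = B + P' + p • R)
    (hcyc1 : ∀ x ∈ localLayerPoints κ (v.adicCompletion K) W 1,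
      ∃ B ∈ AddSubgroup.closure (Set.range fun σ : Field.absoluteGaloisGroup (v.adicCompletion K) ↦ σ • d 1),
        ∃ b ∈ localLayerPoints κ (v.adicCompletion K) W 1, x = B + p • b) :
    signedSelmerInfty W κ (-1) ≤
      sharpFlatSelmerInfty W κ (closureEmb (K := K) (v.adicCompletion K)) 0 g d .sharp := by
  intro s hs
  rw [mem_sharpFlatSelmerInfty_iff]
  refine ⟨signedSelmerInfty_le_selmerInfty W κ (-1) hs, fun σ => ?_⟩
  exact localKummerOverOfEmb_iSup_minus_le_sharpFlatLocalKummer κ (closureEmb (K := K) (v.adicCompletion K)) W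
    κ.kerSubgroup hg hnt hidx hd htr hgen hcyc1
    (SignedTransportAtTwo.conjH1_mem_localKummerOverOfEmb_iSup_of_mem_signedSelmerInfty W κ (-1) hs v hv σ)

variable {E : Type u} [Field E] [Algebra K E] (ι : AlgebraicClosure K →ₐ[K] AlgebraicClosure E)

/-- A class of Sprung's `Sel♯(E/K_∞)` (typed at `ι`) satisfies, at every conjugate `conj_σ`, Kobayashi's minus Kummer condition over
`K_∞` w.r.t. `⨆ₙ E⁻(K_n·K_v)` (§3 applied to the `♯` condition of `conj_σ s`). [cite: Sprung2012, Def. 7.11 (p. 1503)]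
[cite: Kobayashi2003, Def. 1.1] -/
theorem conjH1_mem_localKummerOverOfEmb_iSup_minus_of_mem_sharpFlatSelmerInfty {g : Field.absoluteGaloisGroup E}
    (hg : κ.IsTopGenerator (resGalOfEmb ι g))
    (hnt : ∀ P ∈ localTowerPointsOfEmb κ ι W, p • P = 0 → P = 0)
    {d : ℕ → localPoints W E} (hd : ∀ m, d m ∈ localLayerPointsOfEmb κ ι W m)
    (htr : ∀ m, localTraceOfEmb κ ι W (m + 1) (m + 2) (d (m + 2)) = -d m)
    {s : W.subgroupH1 p κ.kerSubgroup} (hs : s ∈ sharpFlatSelmerInfty W κ ι 0 g d .sharp)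
    (σ : Field.absoluteGaloisGroup K) :
    W.conjH1 p κ.kerSubgroup σ s ∈
      localKummerOverOfEmb W p κ.kerSubgroup ι (⨆ n : ℕ, signedLocalPointsOfEmb κ ι W (-1) n) :=
  sharpFlatLocalKummer_le_localKummerOverOfEmb_iSup_minus κ ι W hg hnt hd htr
    (((mem_sharpFlatSelmerInfty_iff W κ ι 0 g d .sharp s).1 hs).2 σ)

end Global

end SignedKatoOffTwo.SharpKernel

end Summit.BirchSwinnertonDyer.BirchSwinnertonDyer.Theorems

end
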